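import Summits.Ventures.PercRepro.C041TriDomGlueSiblingS

/-!
# ROW C-041 — GLUING AT A CUT VERTEX, VIII: THE COINCIDENT-MARK INSTANCES ARE ELEMENTARY
(p6, gen 45; P6-TWOEXIT-LEAN.md §53 ADDENDUM 16)

When the cut vertex is itself a mark, the near-side statements of the gluing theorems have two coincident marks.
They are all elementary: the crossed classes of the conjecture are empty (a coincident pair is connected in both
colours, `cycDominationS_of_coinc`), and the sibling domination with a coincidence is an identity
(`sibDominationS_coinc_first`, the first mark the terminal), THEOREM (TWO-MARK DOMINATION) in its exclusive form
(`sibDominationS_coinc_second`, the second mark the terminal) or vacuous (`sibDominationS_coinc_marks`, the two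
marks equal).  With them the reduction of ADDENDUM 16 needs no separate treatment of mark cut vertices.
-/

namespace PercRepro

namespace ZoneZ

namespace MultiExit

open ZoneData Finset

variable {V₁ E₁ U₁ U₂ : Type} (Z₁ : ZoneData V₁ E₁ U₁ U₂)

/-- A vertex is red-connected to itself. -/
theorem RdS_self (st : E₁ → EStat) (ω : E₁ → Bool) (a : V₁) : RdS Z₁ st ω a a := mem_reach_self _ _

/-- A vertex is blue-connected to itself. -/
theorem MgS_self (st : E₁ → EStat) (ω : E₁ → Bool) (a : V₁) : MgS Z₁ st ω a a := mem_reach_self _ _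

/-- With two coincident marks no colouring is crossed, on any status. -/
theorem not_cycCrossedS_of_coinc (x y z : V₁) (h : x = y ∨ x = z ∨ y = z) (st : E₁ → EStat) (ω : E₁ → Bool) :
    ¬ CycCrossedS Z₁ x y z st ω := by
  rw [cycCrossedS_iff]
  rcases h with rfl | rfl | rfl
  · simp [RdS_self, MgS_self]
  · simp [RdS_self, MgS_self]
  · simp [RdS_self, MgS_self]

section Counting

variable [Fintype E₁] [DecidableEq E₁]

open Classical in
/-- The conjecture holds on any status when two marks coincide. -/
theorem cycDominationS_of_coinc (x y z : V₁) (h : x = y ∨ x = z ∨ y = z) (st : E₁ → EStat) :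
    CycDominationS Z₁ x y z st := by
  intro V _
  have : (univ.filter fun ω : E₁ → Bool => V ω ∧ CycCrossedS Z₁ x y z st ω) = ∅ :=
    Finset.filter_false_of_mem fun ω _ hc => not_cycCrossedS_of_coinc Z₁ x y z h st ω hc.2
  rw [this, Finset.card_empty]
  exact Nat.zero_le _

open Classical in
/-- The sibling domination with the first mark equal to the terminal is an identity. -/
theorem sibDominationS_coinc_first (w y : V₁) (st : E₁ → EStat) : SibDominationS Z₁ w y w st := by
  intro V _
  refine le_of_eq (card_filter_congr' fun ω _ => ?_)
  unfold SibC₁ SibC₃ SibTop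
  have h1 := RdS_self Z₁ st ω w
  have h2 := MgS_self Z₁ st ω w
  have h3 := RdS_comm Z₁ st ω w y
  have h4 := MgS_comm Z₁ st ω w y
  tauto

open Classical in
/-- The sibling domination with the second mark equal to the terminal is THEOREM (TWO-MARK DOMINATION). -/
theorem sibDominationS_coinc_second (x w : V₁) (st : E₁ → EStat) : SibDominationS Z₁ x w w st := by
  intro V hV
  have h := count_blue_only_le_count_red_only_S Z₁ st x w hV
  refine (card_filter_congr' fun ω _ => ?_).trans_le (h.trans_eq (card_filter_congr' fun ω _ => ?_))
  · unfold SibC₁ SibC₃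
    have h1 := RdS_self Z₁ st ω w
    have h2 := MgS_self Z₁ st ω w
    tauto
  · unfold SibTop
    have h1 := RdS_self Z₁ st ω w
    tauto

open Classical in
/-- The sibling domination with its two marks equal is vacuous. -/
theorem sibDominationS_coinc_marks (w t : V₁) (st : E₁ → EStat) : SibDominationS Z₁ w w t st := by
  intro V _
  have : (univ.filter fun ω : E₁ → Bool => V ω ∧ (SibC₁ Z₁ w w t st ω ∨ SibC₃ Z₁ w w t st ω)) = ∅ := by
    refine Finset.filter_false_of_mem fun ω _ hc => ?_
    unfold SibC₁ SibC₃ at hc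
    have h1 := RdS_self Z₁ st ω w
    have h2 := MgS_self Z₁ st ω w
    tauto
  rw [this, Finset.card_empty]
  exact Nat.zero_le _

end Counting

end MultiExit

end ZoneZ

end PercRepro
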